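import Summits.MatrixMultiplication.OmegaCensus.STPPVosperSlackOneCoverLawA2E
import Summits.MatrixMultiplication.OmegaCensus.STPPVosperCoverQK3Asm
import Summits.MatrixMultiplication.OmegaCensus.STPPVosperCoverQK3B
import Summits.MatrixMultiplication.OmegaCensus.STPPVosperCoverQK3G1
import Summits.MatrixMultiplication.OmegaCensus.STPPVosperCoverQK3G2
import Summits.MatrixMultiplication.OmegaCensus.STPPVosperCoverQK3G3
import Summits.MatrixMultiplication.OmegaCensus.STPPVosperCoverQK3G4
import Summits.MatrixMultiplication.OmegaCensus.STPPVosperCoverEK1Tables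
import Summits.MatrixMultiplication.OmegaCensus.STPPHamidouneRodsethInverseTheorem
import Summits.MatrixMultiplication.OmegaCensus.STPPDisjointPacking
import Summits.MatrixMultiplication.OmegaCensus.STPP222SqSymmetry

/-!
# ω-census (abelian STPP census): K3 `{(1,1,2),(2,3,3),(2,4,3),(3,3,2)}` has no STPP family in `ℤ/61ℤ` — UNCONDITIONAL kernel kill by the slack-1 cover law WITH WORDS over the pairwise-pruned enumerator (kernel)

HONEST FRAMING (pub-omega census; verbatim): lottery ticket; floor = certified bounds/negative ranges.
Census STRUCTURE (seat pub-omega-stpp-2 gen 26, 2026-08-28; leaf assigned by RULINGS L37-114 (b) / L37-120 — the WORDS layer), family (b2).  The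
pattern (`2 + 18 + 24 + 18 = 62 > 61`) is a leaf of the `ℤ₆₁` residual front of record left open by the window-table laws (survivors `30, 31 = ∓2⁻¹`).  Reading: the
family `(A, C, B)` (`STPP222SqNeg.isSTPP_swapBC`), block `2` = `(2,3,4)`: `(z, L, vol, m, n) = (16, 17, 24, 18, 42)`, slack one (`16 + 3 + 24 + 2 + 17 = 62`).
The γ and β window tables `(42, 18, 3)` / `tableBeta 61 43 18 3` (seat stpp-1's `STPPVosperCoverEK1Tables.lean` — the same tables serve K1) have the survivors
`30, 31`; case α₂ has admissible offsets only at `j ∈ {30, 31}` (`STPPVosperCoverQK3Asm.lean`).  For every surviving configuration (γ: 2 × 17 missing indices;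
β: 2 × {run, k = 1, k = 44}; α₂: 2 × 8 × 4 offsets — 104 in all) the Y-first one-pass cover search with the Def-5.1 words among the other blocks
`(2,3,3), (3,2,3), (1,2,1)` FAILS — in fact the `(2,3,3)`-block alone has no word-admissible placement against `Y°`, `Z°` — decided by the kernel through the
pairwise-pruned enumerator `blockDiffsWQ` (`STPPVosperTilingWordsPrunedQ.lean`; rows `STPPVosperCoverQK3G1–4/B/A1–8.lean`, ≈ 20 s each).  Law:
`no_isSTPP_of_slack_one_coverE_prime_a2` (seat stpp-1 gen 32, `STPPVosperSlackOneCoverLawA2E.lean`) with `blockEnumSound_blockDiffsWQ` and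
`hamidouneRodsethInverseTheorem_holds` — UNCONDITIONAL.  Python: HOME `pub-omega-stpp-2-g26/code/coverwq_mirror.py` (exact mirror), `survey_wq.py` (104/104),
seat stpp-2 gen 25's `onepass_words.py` / `k3_234_cert.txt` (independent one-pass search: all 106 configurations dead).  Nothing here is progress on `ω`.

References: H. Cohn, R. Kleinberg, B. Szegedy, C. Umans, FOCS 2005 (arXiv:math/0511460), Def. 5.1; A. G. Vosper, J. London Math. Soc. 31 (1956);
Y. O. Hamidoune, Ø. J. Rødseth, Acta Arith. 92 (2000) 251–262.
-/

open Finset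
open scoped Pointwise

namespace Summit.MatrixMultiplication.OmegaCensus.CubeNB

open Literature.Computability.AlgebraicComplexity
open Literature.Combinatorics.Additive
open Summit.MatrixMultiplication.OmegaCensus.STPPKneser

/-! ## Case γ: the 34 searches collected per ratio -/

section Gamma

/-- Case γ, `j = 30`: for every missing index `ν ≤ 16` the Y-first cover+words search fails. [folklore] -/
theorem cqK3_g_j30 : ∀ ν < 16 + 1,
    existsCoverW 61 ((List.range 17).map fun t => (30 * t) % 61) ((List.range (16 + 1)).filter fun t => decide (t ≠ ν))
        ([(2, 3, 3), (3, 2, 3), (1, 2, 1)].map fun s => blockDiffsWQ 61 ((List.range 17).map fun t => (30 * t) % 61) ((List.range (16 + 1)).filter fun t => decide (t ≠ ν)) s.1 s.2.1 s.2.2) [] [] [] = false ∨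
      existsCoverW 61 ((List.range (16 + 1)).filter fun t => decide (t ≠ ν)) ((List.range 17).map fun t => (30 * t) % 61)
        ([(3, 2, 3), (2, 3, 3), (2, 1, 1)].map fun s => blockDiffsWQ 61 ((List.range (16 + 1)).filter fun t => decide (t ≠ ν)) ((List.range 17).map fun t => (30 * t) % 61) s.1 s.2.1 s.2.2) [] [] [] = false := by
  intro ν hν
  interval_cases ν
  · exact Or.inl cqK3_g_j30_n0
  · exact Or.inl cqK3_g_j30_n1
  · exact Or.inl cqK3_g_j30_n2
  · exact Or.inl cqK3_g_j30_n3
  · exact Or.inl cqK3_g_j30_n4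
  · exact Or.inl cqK3_g_j30_n5
  · exact Or.inl cqK3_g_j30_n6
  · exact Or.inl cqK3_g_j30_n7
  · exact Or.inl cqK3_g_j30_n8
  · exact Or.inl cqK3_g_j30_n9
  · exact Or.inl cqK3_g_j30_n10
  · exact Or.inl cqK3_g_j30_n11
  · exact Or.inl cqK3_g_j30_n12
  · exact Or.inl cqK3_g_j30_n13
  · exact Or.inl cqK3_g_j30_n14
  · exact Or.inl cqK3_g_j30_n15
  · exact Or.inl cqK3_g_j30_n16

/-- Case γ, `j = 31`: for every missing index `ν ≤ 16` the Y-first cover+words search fails. [folklore] -/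
theorem cqK3_g_j31 : ∀ ν < 16 + 1,
    existsCoverW 61 ((List.range 17).map fun t => (31 * t) % 61) ((List.range (16 + 1)).filter fun t => decide (t ≠ ν))
        ([(2, 3, 3), (3, 2, 3), (1, 2, 1)].map fun s => blockDiffsWQ 61 ((List.range 17).map fun t => (31 * t) % 61) ((List.range (16 + 1)).filter fun t => decide (t ≠ ν)) s.1 s.2.1 s.2.2) [] [] [] = false ∨
      existsCoverW 61 ((List.range (16 + 1)).filter fun t => decide (t ≠ ν)) ((List.range 17).map fun t => (31 * t) % 61)
        ([(3, 2, 3), (2, 3, 3), (2, 1, 1)].map fun s => blockDiffsWQ 61 ((List.range (16 + 1)).filter fun t => decide (t ≠ ν)) ((List.range 17).map fun t => (31 * t) % 61) s.1 s.2.1 s.2.2) [] [] [] = false := by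
  intro ν hν
  interval_cases ν
  · exact Or.inl cqK3_g_j31_n0
  · exact Or.inl cqK3_g_j31_n1
  · exact Or.inl cqK3_g_j31_n2
  · exact Or.inl cqK3_g_j31_n3
  · exact Or.inl cqK3_g_j31_n4
  · exact Or.inl cqK3_g_j31_n5
  · exact Or.inl cqK3_g_j31_n6
  · exact Or.inl cqK3_g_j31_n7
  · exact Or.inl cqK3_g_j31_n8
  · exact Or.inl cqK3_g_j31_n9
  · exact Or.inl cqK3_g_j31_n10
  · exact Or.inl cqK3_g_j31_n11
  · exact Or.inl cqK3_g_j31_n12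
  · exact Or.inl cqK3_g_j31_n13
  · exact Or.inl cqK3_g_j31_n14
  · exact Or.inl cqK3_g_j31_n15
  · exact Or.inl cqK3_g_j31_n16

/-- Split of the γ target: words, or (`j = 30, 31`) the failed searches for every missing index. [folklore] -/
theorem splitQK3_gamma : ∀ jv ∈ ({0, 1, 60, 2, 59, 30, 31} : Finset ℕ),
    (jv = 0 ∨ (∃ k ∈ range 3, 1 ≤ k ∧ (jv = k ∨ jv + k = 61)) ∨ (∃ k ∈ range 2, 1 ≤ k ∧ (jv * k % 61 = 1 ∨ jv * k % 61 = 61 - 1))) ∨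
      ∀ ν < 16 + 1, existsCoverW 61 ((List.range 17).map fun t => (jv * t) % 61) ((List.range (16 + 1)).filter fun t => decide (t ≠ ν))
          ([(2, 3, 3), (3, 2, 3), (1, 2, 1)].map fun s => blockDiffsWQ 61 ((List.range 17).map fun t => (jv * t) % 61) ((List.range (16 + 1)).filter fun t => decide (t ≠ ν)) s.1 s.2.1 s.2.2) [] [] [] = false ∨
        existsCoverW 61 ((List.range (16 + 1)).filter fun t => decide (t ≠ ν)) ((List.range 17).map fun t => (jv * t) % 61)
          ([(3, 2, 3), (2, 3, 3), (2, 1, 1)].map fun s => blockDiffsWQ 61 ((List.range (16 + 1)).filter fun t => decide (t ≠ ν)) ((List.range 17).map fun t => (jv * t) % 61) s.1 s.2.1 s.2.2) [] [] [] = false := by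
  intro jv hjv
  have hcases : jv ∈ ({0, 1, 60, 2, 59} : Finset ℕ) ∨ jv = 30 ∨ jv = 31 := by
    revert hjv; revert jv; decide
  rcases hcases with h | rfl | rfl
  · exact Or.inl (target_61_a2_b3 jv h)
  · exact Or.inr cqK3_g_j30
  · exact Or.inr cqK3_g_j31

end Gamma

/-! ## Case β: split of the target -/

section Beta

/-- Split of the β target: words, or (`j = 30, 31`) the failed searches (`STPPVosperCoverQK3B.lean`). [folklore] -/
theorem splitQK3_beta : ∀ jv ∈ ({0, 1, 60, 2, 59, 30, 31} : Finset ℕ),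
    (jv = 0 ∨ (∃ k ∈ range 3, 1 ≤ k ∧ (jv = k ∨ jv + k = 61)) ∨ (∃ k ∈ range 2, 1 ≤ k ∧ (jv * k % 61 = 1 ∨ jv * k % 61 = 61 - 1))) ∨
      ((∀ k < 3 + 42 + 1, (2 ≤ k ∧ k + 2 ≤ 3 + 42) ∨ k = 0 ∨ k = 3 + 42 ∨
          (existsCoverW 61 ((List.range 17).map fun t => (jv * t) % 61) (List.range (16 - 1) ++ [k + 16 - 1])
              ([(2, 3, 3), (3, 2, 3), (1, 2, 1)].map fun s => blockDiffsWQ 61 ((List.range 17).map fun t => (jv * t) % 61) (List.range (16 - 1) ++ [k + 16 - 1]) s.1 s.2.1 s.2.2) [] [] [] = false ∨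
            existsCoverW 61 (List.range (16 - 1) ++ [k + 16 - 1]) ((List.range 17).map fun t => (jv * t) % 61)
              ([(3, 2, 3), (2, 3, 3), (2, 1, 1)].map fun s => blockDiffsWQ 61 (List.range (16 - 1) ++ [k + 16 - 1]) ((List.range 17).map fun t => (jv * t) % 61) s.1 s.2.1 s.2.2) [] [] [] = false)) ∧
        (existsCoverW 61 ((List.range 17).map fun t => (jv * t) % 61) (List.range 16)
              ([(2, 3, 3), (3, 2, 3), (1, 2, 1)].map fun s => blockDiffsWQ 61 ((List.range 17).map fun t => (jv * t) % 61) (List.range 16) s.1 s.2.1 s.2.2) [] [] [] = false ∨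
          existsCoverW 61 (List.range 16) ((List.range 17).map fun t => (jv * t) % 61)
              ([(3, 2, 3), (2, 3, 3), (2, 1, 1)].map fun s => blockDiffsWQ 61 (List.range 16) ((List.range 17).map fun t => (jv * t) % 61) s.1 s.2.1 s.2.2) [] [] [] = false)) := by
  intro jv hjv
  have hcases : jv ∈ ({0, 1, 60, 2, 59} : Finset ℕ) ∨ jv = 30 ∨ jv = 31 := by
    revert hjv; revert jv; decide
  rcases hcases with h | rfl | rfl
  · exact Or.inl (target_61_a2_b3 jv h)
  · exact Or.inr cqK3_b_j30
  · exact Or.inr cqK3_b_j31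

end Beta

/-! ## The kill -/

section Kill

/-- **K3 `{(1,1,2),(2,3,3),(2,4,3),(3,3,2)}` has no STPP family in `ℤ/61ℤ`** — UNCONDITIONAL (slack-1 law for `a = 2` with cover+words escapes over the
pairwise-pruned enumerator, family `(A, C, B)`, block `2`; see the module docstring). [cite: CohnKleinbergSzegedyUmans2005, Def. 5.1]
[cite: Vosper1956, main theorem; Nathanson1996, Thm 2.7] [cite: HamidouneRodseth2000, main theorem (§1, p. 252)] -/
theorem no_isSTPP_zmod61_112_233_243_332 (A B C : Fin 4 → Finset (ZMod 61)) (hS : IsSTPP A B C)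
    (hA : ∀ i, #(A i) = ![1, 2, 2, 3] i) (hB : ∀ i, #(B i) = ![1, 3, 4, 3] i) (hC : ∀ i, #(C i) = ![2, 3, 3, 2] i) : False := by
  haveI : Fact (Nat.Prime 61) := ⟨by norm_num⟩
  have hS' : IsSTPP A C B := STPP222SqNeg.isSTPP_swapBC hS
  have hAne : ∀ i, (A i).Nonempty := fun i => card_pos.1 (by rw [hA]; fin_cases i <;> simp)
  have hBne : ∀ i, (B i).Nonempty := fun i => card_pos.1 (by rw [hB]; fin_cases i <;> simp)
  have hCne : ∀ i, (C i).Nonempty := fun i => card_pos.1 (by rw [hC]; fin_cases i <;> simp)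
  have e2 : (univ : Finset (Fin 4)).erase 2 = {0, 1, 3} := by decide
  have hz : ∑ k ∈ (univ : Finset (Fin 4)).erase 2, #(A k) * #(B k) = 16 := by
    rw [e2]; simp [Finset.sum_insert, hA, hB]
  have hL : ∑ k ∈ (univ : Finset (Fin 4)).erase 2, #(C k) * #(B k) = 17 := by
    rw [e2]; simp [Finset.sum_insert, hB, hC]
  have ha : #(A 2) = 2 := by rw [hA]; simp
  have hb : #(C 2) = 3 := by rw [hC]; simp
  have hvol : #(A 2) * #(C 2) * #(B 2) = 24 := by rw [hA, hB, hC]; simp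
  have hsAB : [(2, 3, 3), (3, 2, 3), (1, 2, 1)] = ([1, 3, 0] : List (Fin 4)).map (fun k => (#(A k), #(C k), #(B k))) := by simp [hA, hB, hC]
  have hsBA : [(3, 2, 3), (2, 3, 3), (2, 1, 1)] = ([1, 3, 0] : List (Fin 4)).map (fun k => (#(C k), #(A k), #(B k))) := by simp [hA, hB, hC]
  exact no_isSTPP_of_slack_one_coverE_prime_a2 (blockEnumSound_blockDiffsWQ 61) hamidouneRodsethInverseTheorem_holds A C B hS' hAne hCne hBne 2
    ⟨0, by decide⟩ ha hb hvol hz hL rfl (by norm_num) (by norm_num) (by norm_num) (by norm_num) (m := 18) (n := 42) rfl rfl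
    [1, 3, 0] (by decide) (fun k => by fin_cases k <;> decide) [(2, 3, 3), (3, 2, 3), (1, 2, 1)] hsAB [(3, 2, 3), (2, 3, 3), (2, 1, 1)] hsBA false
    (Jγ := {0, 1, 60, 2, 59, 30, 31}) (Jα := {0, 1, 60, 2, 59}) (Jβ := {0, 1, 60, 2, 59, 30, 31})
    table61_42_18_3_K1 splitQK3_gamma specQK3 target_61_a2_b3 tableB61_43_18_3 splitQK3_beta

end Kill

end Summit.MatrixMultiplication.OmegaCensus.CubeNB
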